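import Mathlib
import HarnessLib
import Literature.Analysis.FluidPDE.ClassicalSolution
import Literature.Analysis.FluidPDE.SuitableWeak
import Literature.Analysis.FluidPDE.BarkerPrangeLocalizedSmoothingBounds
import Literature.Analysis.FluidPDE.BarkerPrangeConcentrationProofs
import Literature.Analysis.FluidPDE.AncientWeakL3BackwardLiouvilleAssembly
import Summits.NavierStokesRegularity.NavierStokesRegularity.Theorems.QuarterLogPincerBeadCensusDefs
import Summits.NavierStokesRegularity.NavierStokesRegularity.Theorems.QuarterLogPincerFlatChainDefs
import Summits.NavierStokesRegularity.NavierStokesRegularity.Theorems.QuarterLogPincerFlatChainKernel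
import Summits.NavierStokesRegularity.NavierStokesRegularity.Theorems.QuarterLogPincerFlatChainSliceDefs
import Summits.NavierStokesRegularity.NavierStokesRegularity.Theorems.QuarterLogPincerFlatChainSliceFrame
import Summits.NavierStokesRegularity.NavierStokesRegularity.Theorems.QuarterLogPincerFlatChainSlicePressure
import Summits.NavierStokesRegularity.NavierStokesRegularity.Theorems.QuarterLogPincerFlatChainLevelConcentrationTools
import Summits.NavierStokesRegularity.NavierStokesRegularity.Theorems.QuarterLogPincerFlatChainBoundedRegularity
import Summits.NavierStokesRegularity.NavierStokesRegularity.Theorems.QuarterLogPincerFlatChainAssembly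

/-!
# Route `QuarterLogPincer`, crux `TypeIQuantSubcubicExp` (stmt-NavierStokesRegularity-24077), line `flat_chain` —
# β: a LIGHT block at the slice time is a REGULAR block (`LightSliceRegular`), β|P and β PROVED

The registered stub β|P `stub_lightSliceRegular_of_slice : LocalEnergySlice → LightSliceRegular` of ns-idea-7 g14's
skeleton `Cruxes/TypeIQuantSubcubicExp/Lines/flat_chain.lean` (v1.13, its LAST `sorry`), and — with P
`stub_localEnergySlice` (PROVED, `…FlatChainSlicePressure`) — the unconditional `lightSliceRegular_holds : LightSliceRegular`.

Proof (all ingredients PROVED tree theorems).  Fix `M ≥ 1`; P gives the uloc budget `Mt(M)`, Barker–Prange (i)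
(`BarkerPrange2020_thm1_slab_bounds`, at `β₀ = S/2`) the constants `γ, S(Mt) ≤ 1/4, C_b`, and `boundedRegularity`
(`…FlatChainBoundedRegularity`) the constants `θ, κ, c⋆`.  Put `ϑ := √(8/S)`, `c := min(ϑ/6, 1/2, κϑ/(2C_b))`,
`C_g := c⋆(θc)^{-3}`, `a₂ := 1 + 1/S`.  Given a level `k+1` with scale `s`, `q = √s`, a `γ`-light block
`{ρq ≤ |x−x₀| ≤ 4Λρq}` at the slice time `t⋆ = t₁ − 2s` (`≥ 0` since `e^{2a} ≥ 2`) and a point `x` of the annulus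
`(2ρq, 2Λρq)`, `t ∈ [t₁ − s/32, t₁]`:
* P at `(x, t⋆, r = ϑq/2, S)` (`Sr² = 2s`, so the window is `[t⋆, t₁]`; `r² = 2s/S ≤ T` since `e^{2a} ≥ 2/S`) makes
  `v = sliceField u x t⋆ r` a local energy solution on `(0,S)` with `E²` datum and uloc bound `Mt`;
* the light test ball `B(x, ϑq) = B(x, 2r)` gives `‖v(0)‖_{L³(B₂(0))} ≤ γ` (cube mass is scale invariant:
  `eLpNorm_comp_add_smul_ball`);
* Barker–Prange (i): `‖v‖ ≤ C_b` a.e. on `(S/2, S) × B(0, 1/3)`, hence everywhere there (`v` is continuous: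
  `sliceField_continuousOn`, `norm_le_of_ae_le_of_continuousOn`), i.e. `‖u‖ ≤ C_b/r` on `(t₁ − s, t₁) × B(x, r/3)`;
* `boundedRegularity` on the cylinder `Q_{cq}(t, x) ⊂ (t₁ − s, t₁) × B(x, r/3)` (`c ≤ ϑ/6`, `c ≤ 1/2`) with
  `K = C_b/r`, `K·cq = 2C_b c/ϑ ≤ κ`: `‖∇ʲu(t,x)‖ ≤ c⋆(θcq)^{-(j+1)} ≤ C_g s^{-(j+1)/2}` (`j ≤ 2`, `θc ≤ 1`);
* the regular block is `R := 2ρq`: `4Mq ≤ R` (`ρ ≥ 4M`), `ΛR ≤ e^{a}q` (`4Λρ ≤ e^{a}`), and `(R, ΛR) ⊂ [ρq, 4Λρq]`.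

Consequently (`…FlatChainAssembly` part 2) LINE g14-2 / g15-1 closes down to its census node BY NAME:
`typeIQuantCubicExp_of_sliceCensus_alone : SliceCensus → TypeIQuantCubicExp` (R0-rate rung `CubicRung.TypeIQuantCubicExp`).

HONEST FRAMING: a theorem about HYPOTHETICAL Type-I classical solutions composed from PROVED tree results; it closes one
registered stub of one line (v1.13 β|P; v1.14 splits it into B1|P + B2, which it implies nothing about by name); the
census node `SliceCensus` is OPEN; nothing here bears on the truth of ⟨24077⟩, W7 or Navier–Stokes regularity (OPEN /
not proved).  pub-ns-dss typer (g39), `--supports stmt-NavierStokesRegularity-24077`.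
-/

set_option linter.dupNamespace false

noncomputable section

open MeasureTheory Set Function Filter Topology Metric
open scoped ENNReal NNReal
open Literature.Analysis Literature.Analysis.FluidPDE
open Summit.NavierStokesRegularity.NavierStokesRegularity.Cruxes.TypeIQuantSubcubicExp.BeadCensus (levelScale)

namespace Summit.NavierStokesRegularity.NavierStokesRegularity.Cruxes.TypeIQuantSubcubicExp.FlatChain

/-- **β|P (PROVED).** `LocalEnergySlice → LightSliceRegular` — see the module docstring. -/
theorem lightSliceRegular_of_slice_holds : LocalEnergySlice → LightSliceRegular := by
  intro hP M hM
  -- ## constants depending on `M` only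
  obtain ⟨Mt, hMt, HP⟩ := hP M
  obtain ⟨γ, hγ, HBP⟩ := BarkerPrange2020_thm1_slab_bounds
  obtain ⟨S, hS, hS4, HS⟩ := HBP Mt hMt
  obtain ⟨Cb, C₁, hCb, -, HB⟩ := HS (S / 2) ⟨by linarith, by linarith⟩
  have hS1 : S ≤ 1 := hS4.trans (by norm_num)
  obtain ⟨θ, κ, cs, hθ, hθ1, hκ, hcs, HR⟩ := boundedRegularity M hM
  obtain ⟨ϑ, hϑdef⟩ : ∃ ϑ : ℝ, Real.sqrt (8 / S) = ϑ := ⟨_, rfl⟩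
  have hϑ0 : 0 < ϑ := by rw [← hϑdef]; exact Real.sqrt_pos.2 (by positivity)
  have hϑ2 : ϑ ^ 2 = 8 / S := by rw [← hϑdef]; exact Real.sq_sqrt (by positivity)
  have hϑ1 : 1 ≤ ϑ := by
    rw [← hϑdef, ← Real.sqrt_one]
    refine Real.sqrt_le_sqrt ?_
    rw [le_div_iff₀ hS]; linarith
  obtain ⟨c, hcdef⟩ : ∃ c : ℝ, min (min (ϑ / 6) (1 / 2)) (κ * ϑ / (2 * Cb)) = c := ⟨_, rfl⟩
  have hc0 : 0 < c := by rw [← hcdef]; exact lt_min (lt_min (by positivity) (by norm_num)) (by positivity)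
  have hc6 : c ≤ ϑ / 6 := by rw [← hcdef]; exact (min_le_left _ _).trans (min_le_left _ _)
  have hc2 : c ≤ 1 / 2 := by rw [← hcdef]; exact (min_le_left _ _).trans (min_le_right _ _)
  have hcκ : c ≤ κ * ϑ / (2 * Cb) := by rw [← hcdef]; exact min_le_right _ _
  have hθc0 : 0 < θ * c := mul_pos hθ hc0
  have hθc1 : θ * c ≤ 1 := by nlinarith only [hθ, hθ1, hc0, hc2]
  obtain ⟨Cg, hCgdef⟩ : ∃ Cg : ℝ, cs * (θ * c) ^ (-(3 : ℝ)) = Cg := ⟨_, rfl⟩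
  have hCg1 : 1 ≤ Cg := by
    rw [← hCgdef]
    have h1 : 1 ≤ (θ * c) ^ (-(3 : ℝ)) := Real.one_le_rpow_of_pos_of_le_one_of_nonpos hθc0 hθc1 (by norm_num)
    nlinarith only [hcs, h1]
  have hpS : 0 < 1 / S := by positivity
  refine ⟨Cg, γ, ϑ, 1 + 1 / S, hCg1, hγ, hϑ1, by positivity, ?_⟩
  intro Λ a hΛ ha T τ t₁ x₀ u p k ρ hfr hτ hrate ht₁ hρM _ hΛρ hlight
  have ha1 : 1 ≤ a := by linarith only [ha, hpS]
  have ha0 : 0 ≤ a := by linarith only [ha1]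
  have haS : 1 / S ≤ a := by linarith only [ha]
  have hexp2a : 2 * a + 1 ≤ Real.exp (2 * a) := Real.add_one_le_exp (2 * a)
  have he2a2 : Real.exp (-(2 * a)) ≤ 1 / 2 := q4_exp_neg_le (by linarith only [hexp2a, ha1])
  have he2aS : Real.exp (-(2 * a)) ≤ S / 2 := by
    refine q4_exp_neg_le ?_
    have h1 : 1 ≤ a * S := by rw [div_le_iff₀ hS] at haS; exact haS
    nlinarith only [h1, hexp2a, hS]
  have hΛ0 : 0 < Λ := by linarith only [hΛ]
  have hρ0 : 0 < ρ := by linarith only [hM, hρM]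
  -- ## the scales of level `k+1`: `s`, `q = √s`, `t⋆ = t₁ − 2s`, `r = ϑq/2`
  have ht₁0 : 0 < t₁ := ht₁.1
  have ht₁T : t₁ ≤ T := ht₁.2
  obtain ⟨s, hsdef⟩ : ∃ s : ℝ, levelScale a t₁ (k + 1) = s := ⟨_, rfl⟩
  have hs0 : 0 < s := by rw [← hsdef]; exact (levelScale_pos_le ha0 ht₁0 _).1
  have hsle : s ≤ t₁ * Real.exp (-(2 * a)) := by
    rw [← hsdef]
    unfold levelScale
    refine mul_le_mul_of_nonneg_left (Real.exp_le_exp.2 ?_) ht₁0.le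
    have hk1 : (1 : ℝ) ≤ ((k + 1 : ℕ) : ℝ) := by exact_mod_cast Nat.le_add_left 1 k
    have h := mul_le_mul_of_nonneg_left hk1 (by linarith only [ha0] : (0 : ℝ) ≤ 2 * a)
    linarith only [h]
  have h2s : 2 * s ≤ t₁ := by
    have h := mul_le_mul_of_nonneg_left he2a2 ht₁0.le
    linarith only [hsle, h]
  have hsS : 2 * s / S ≤ T := by
    have h := mul_le_mul_of_nonneg_left he2aS ht₁0.le
    rw [div_le_iff₀ hS]
    nlinarith only [hsle, h, ht₁T, hS]
  obtain ⟨q, hqdef⟩ : ∃ q : ℝ, Real.sqrt s = q := ⟨_, rfl⟩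
  have hq0 : 0 < q := by rw [← hqdef]; exact Real.sqrt_pos.2 hs0
  have hq2 : q ^ 2 = s := by rw [← hqdef]; exact Real.sq_sqrt hs0.le
  obtain ⟨tstar, htsdef⟩ : ∃ t' : ℝ, t₁ - 2 * s = t' := ⟨_, rfl⟩
  have hts0 : 0 ≤ tstar := by rw [← htsdef]; linarith only [h2s]
  have hslice : sliceTime a t₁ (k + 1) = tstar := by
    rw [← htsdef, ← hsdef]; rfl
  obtain ⟨r, hrdef⟩ : ∃ r' : ℝ, ϑ * q / 2 = r' := ⟨_, rfl⟩
  have hr0 : 0 < r := by rw [← hrdef]; positivity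
  have h2r : ϑ * q = 2 * r := by rw [← hrdef]; ring
  have hr2 : r ^ 2 = 2 * s / S := by
    rw [← hrdef, div_pow, mul_pow, hϑ2, hq2]; field_simp; ring
  have hSr : S * r ^ 2 = 2 * s := by rw [hr2]; field_simp
  have hwin : tstar + S * r ^ 2 ≤ T := by rw [hSr, ← htsdef]; linarith only [ht₁T]
  have hr2T : r ^ 2 ≤ T := by rw [hr2]; exact hsS
  -- ## the regular block `R := 2ρq`
  have hΛρq : 0 ≤ Λ * ρ * q := by positivity
  refine ⟨2 * ρ * q, ?_, ?_, ?_⟩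
  · rw [hsdef, hqdef]; nlinarith only [hρM, hq0, hM, hρ0]
  · rw [hsdef, hqdef]; linarith only [mul_le_mul_of_nonneg_right hΛρ hq0.le, hΛρq]
  rw [hsdef]
  intro t ht x hRx hxΛ j hj
  -- the light test ball about `x` at the slice time
  have hcube : ∫⁻ y in ball x (2 * r), ‖u tstar y‖ₑ ^ (3 : ℝ) ≤ ENNReal.ofReal (γ ^ 3) := by
    have h := hlight x
    rw [hsdef, hqdef, hslice, h2r] at h
    refine h ?_ ?_
    · nlinarith only [hRx, hρ0, hq0]
    · linarith only [hxΛ, hΛρq]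
  -- ## P: the rescaled slice about `(t⋆, x)` is a local energy solution with `E²` datum and uloc bound `Mt`
  obtain ⟨π, hles, hE2, huloc⟩ := HP T τ u p hfr hτ hrate x tstar r S hr0 hS hS1 hts0 hr2T hwin
  -- ## `‖u(t⋆)‖_{L³(B(x,2r))} ≤ γ`, transported to the rescaled datum: `‖v(0)‖_{L³(B(0,2))} ≤ γ`
  have hcube' : ∫⁻ y in ball x (2 * r), ‖u tstar y‖ₑ ^ 3 ≤ ENNReal.ofReal (γ ^ 3) := by
    have e : ∫⁻ y in ball x (2 * r), ‖u tstar y‖ₑ ^ (3 : ℝ) = ∫⁻ y in ball x (2 * r), ‖u tstar y‖ₑ ^ 3 :=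
      lintegral_congr fun y => by rw [show (3 : ℝ) = ((3 : ℕ) : ℝ) by norm_num, ENNReal.rpow_natCast]
    rw [← e]; exact hcube
  have hL3u : eLpNorm (u tstar) 3 (volume.restrict (ball x (2 * r))) ≤ ENNReal.ofReal γ := by
    rw [eLpNorm_eq_lintegral_rpow_enorm_toReal three_ne_zero ENNReal.ofNat_ne_top, ENNReal.toReal_ofNat]
    have e3 : ∫⁻ y in ball x (2 * r), ‖u tstar y‖ₑ ^ (3 : ℝ) = ∫⁻ y in ball x (2 * r), ‖u tstar y‖ₑ ^ 3 :=
      lintegral_congr fun y => by rw [show (3 : ℝ) = ((3 : ℕ) : ℝ) by norm_num, ENNReal.rpow_natCast]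
    rw [e3]
    calc (∫⁻ y in ball x (2 * r), ‖u tstar y‖ₑ ^ 3) ^ (1 / (3 : ℝ)) ≤ (ENNReal.ofReal (γ ^ 3)) ^ (1 / (3 : ℝ)) :=
          ENNReal.rpow_le_rpow hcube' (by norm_num)
      _ = ENNReal.ofReal ((γ ^ 3) ^ (1 / (3 : ℝ))) := ENNReal.ofReal_rpow_of_nonneg (by positivity) (by norm_num)
      _ = ENNReal.ofReal γ := by
          rw [← Real.rpow_natCast γ 3, ← Real.rpow_mul hγ.le]; norm_num
  have hv0 : sliceField u x tstar r 0 = fun y => r • u tstar (x + r • y) := by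
    funext y; rw [sliceField_apply, mul_zero, add_zero]
  have hsmul : ∀ (q' : ℝ≥0∞) (μ : Measure (EuclideanSpace ℝ (Fin 3))),
      eLpNorm (fun y => r • u tstar (x + r • y)) q' μ = ‖r‖ₑ * eLpNorm (fun y => u tstar (x + r • y)) q' μ :=
    fun q' μ => by
      rw [show (fun y => r • u tstar (x + r • y)) = r • fun y => u tstar (x + r • y) from rfl, eLpNorm_const_smul]
  have hlr : ‖r‖ₑ = ENNReal.ofReal r := Real.enorm_eq_ofReal hr0.le
  have hL3' : eLpNorm (sliceField u x tstar r 0) 3 (volume.restrict (ball (0 : EuclideanSpace ℝ (Fin 3)) 2)) ≤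
      ENNReal.ofReal γ := by
    rw [hv0]
    calc eLpNorm (fun y => r • u tstar (x + r • y)) 3 (volume.restrict (ball (0 : EuclideanSpace ℝ (Fin 3)) 2))
        = ‖r‖ₑ * (ENNReal.ofReal ((r ^ 3)⁻¹) ^ (1 / (3 : ℝ≥0∞)).toReal *
            eLpNorm (u tstar) 3 (volume.restrict (ball (x + r • (0 : EuclideanSpace ℝ (Fin 3))) (r * 2)))) := by
          rw [hsmul, eLpNorm_comp_add_smul_ball (u tstar) x 0 hr0 2 (by norm_num)]
      _ ≤ ‖r‖ₑ * (ENNReal.ofReal r⁻¹ * ENNReal.ofReal γ) := by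
          rw [ofReal_inv_cube_rpow_third hr0, smul_zero, add_zero, mul_comm r 2]
          gcongr
      _ = ENNReal.ofReal γ := by
          rw [hlr, ← ENNReal.ofReal_mul (by positivity), ← ENNReal.ofReal_mul (by positivity)]
          congr 1
          field_simp
  -- ## Barker–Prange (i): `‖v‖ ≤ Cb` a.e. on `(S/2,S) × B(0,1/3)`, hence everywhere there
  obtain ⟨hae, -, -⟩ := HB _ _ π hles hE2 huloc hL3'
  have hcontv := sliceField_continuousOn hfr.1 x hr0 hS hts0 hwin
  set U : Set (ℝ × EuclideanSpace ℝ (Fin 3)) := Ioo (S / 2) S ×ˢ ball (0 : EuclideanSpace ℝ (Fin 3)) (1 / 3) with hU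
  have hUsub : U ⊆ Icc 0 S ×ˢ (univ : Set (EuclideanSpace ℝ (Fin 3))) :=
    prod_mono (fun s' hs' => ⟨by linarith [hs'.1], hs'.2.le⟩) (subset_univ _)
  have hae' : ∀ᵐ z ∂(volume.restrict U), ‖Function.uncurry (sliceField u x tstar r) z‖ ≤ Cb :=
    hae.mono fun w hw => hw
  have hall := norm_le_of_ae_le_of_continuousOn (isOpen_Ioo.prod isOpen_ball) (hcontv.mono hUsub) hae'
  -- ## `‖u‖ ≤ Cb/r` on the cylinder `Q_{cq}(t, x) ⊂ (t₁ − s, t₁) × B(x, r/3)`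
  obtain ⟨ϱ, hϱdef⟩ : ∃ ϱ' : ℝ, c * q = ϱ' := ⟨_, rfl⟩
  have hϱ0 : 0 < ϱ := by rw [← hϱdef]; positivity
  have hϱ2 : ϱ ^ 2 ≤ s / 4 := by
    have hc4 : c ^ 2 ≤ 1 / 4 := by nlinarith only [hc0, hc2]
    rw [← hϱdef, mul_pow, hq2]; nlinarith only [hc4, hs0]
  have hK : ∀ w ∈ parabolicCylinder ϱ (t, x), ‖u w.1 w.2‖ ≤ Cb / r := by
    intro w hw
    simp only [mem_parabolicCylinder, dist_eq_norm] at hw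
    obtain ⟨⟨hw1, hw2⟩, hw3⟩ := hw
    have hσ1 : S / 2 < (w.1 - tstar) / r ^ 2 := by
      rw [lt_div_iff₀ (pow_pos hr0 2)]
      have e : S / 2 * r ^ 2 = s := by linarith only [hSr]
      rw [e]
      linarith only [hw1, ht.1, hϱ2, htsdef, hs0]
    have hσ2 : (w.1 - tstar) / r ^ 2 < S := by
      rw [div_lt_iff₀ (pow_pos hr0 2), hSr]
      linarith only [hw2, ht.2, htsdef]
    have hη : r⁻¹ • (w.2 - x) ∈ ball (0 : EuclideanSpace ℝ (Fin 3)) (1 / 3) := by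
      rw [mem_ball_zero_iff, norm_smul, Real.norm_of_nonneg (inv_nonneg.2 hr0.le)]
      have e : r⁻¹ * ϱ = 2 * c / ϑ := by
        rw [← hϱdef, ← hrdef, inv_mul_eq_div, div_eq_div_iff (by positivity) hϑ0.ne']; ring
      calc r⁻¹ * ‖w.2 - x‖ < r⁻¹ * ϱ := mul_lt_mul_of_pos_left hw3 (inv_pos.2 hr0)
        _ = 2 * c / ϑ := e
        _ ≤ 1 / 3 := by rw [div_le_iff₀ hϑ0]; linarith only [hc6]
    have hwU : ((w.1 - tstar) / r ^ 2, r⁻¹ • (w.2 - x)) ∈ U := ⟨⟨hσ1, hσ2⟩, hη⟩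
    have hb := hall _ hwU
    have e1 : tstar + r ^ 2 * ((w.1 - tstar) / r ^ 2) = w.1 := by
      rw [mul_div_cancel₀ _ (pow_ne_zero 2 hr0.ne')]; ring
    have e2 : x + r • (r⁻¹ • (w.2 - x)) = w.2 := by
      rw [smul_smul, mul_inv_cancel₀ hr0.ne', one_smul, add_sub_cancel]
    rw [Function.uncurry_apply_pair, sliceField_apply, e1, e2, norm_smul, Real.norm_of_nonneg hr0.le] at hb
    rw [le_div_iff₀ hr0, mul_comm]
    exact hb
  -- ## bounded regularity on `Q_{cq}(t, x)`
  have hKϱ : Cb / r * ϱ ≤ κ := by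
    have e : Cb / r * ϱ = 2 * Cb * c / ϑ := by rw [← hϱdef, ← hrdef]; field_simp
    rw [e, div_le_iff₀ hϑ0]
    have h := mul_le_mul_of_nonneg_left hcκ (by positivity : (0 : ℝ) ≤ 2 * Cb)
    have e' : 2 * Cb * (κ * ϑ / (2 * Cb)) = κ * ϑ := by field_simp
    linarith only [h, e']
  have hϱt : ϱ ^ 2 ≤ (t, x).1 := by
    show ϱ ^ 2 ≤ t
    linarith only [hϱ2, ht.1, h2s, hs0]
  have htT : (t, x).1 ≤ T := by
    show t ≤ T
    exact ht.2.trans ht₁T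
  have hreg := HR T τ u p hfr hτ hrate (Cb / r) (t, x) ϱ (by positivity) hϱ0 hϱt htT hK hKϱ t
    ⟨by show t - (θ * ϱ / 2) ^ 2 ≤ t; nlinarith only [hθ, hϱ0], le_refl t⟩ x (mem_ball_self (by positivity)) j hj
  -- ## the exponents: `c⋆(θcq)^{-(j+1)} ≤ C_g s^{-(j+1)/2}`
  have hj2 : (j : ℝ) ≤ 2 := by exact_mod_cast hj
  have key : (θ * ϱ) ^ (-((j : ℝ) + 1)) = (θ * c) ^ (-((j : ℝ) + 1)) * s ^ (-(((j : ℝ) + 1) / 2)) := by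
    rw [← hϱdef, show θ * (c * q) = (θ * c) * q by ring, Real.mul_rpow hθc0.le hq0.le, ← hqdef,
      Real.sqrt_eq_rpow, ← Real.rpow_mul hs0.le,
      show (1 / 2 : ℝ) * (-((j : ℝ) + 1)) = -(((j : ℝ) + 1) / 2) by ring]
  have hmono : (θ * c) ^ (-((j : ℝ) + 1)) ≤ (θ * c) ^ (-(3 : ℝ)) :=
    Real.rpow_le_rpow_of_exponent_ge hθc0 hθc1 (by linarith only [hj2])
  have hspow : 0 ≤ s ^ (-(((j : ℝ) + 1) / 2)) := Real.rpow_nonneg hs0.le _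
  calc ‖iteratedFDeriv ℝ j (u t) x‖ ≤ cs * (θ * ϱ) ^ (-((j : ℝ) + 1)) := hreg
    _ = cs * (θ * c) ^ (-((j : ℝ) + 1)) * s ^ (-(((j : ℝ) + 1) / 2)) := by rw [key, mul_assoc]
    _ ≤ cs * (θ * c) ^ (-(3 : ℝ)) * s ^ (-(((j : ℝ) + 1) / 2)) := by gcongr
    _ = Cg * s ^ (-(((j : ℝ) + 1) / 2)) := by rw [hCgdef]

/-- β|P under its registered skeleton name (ns-idea-7 g14 `Lines/flat_chain.lean` v1.13). -/
theorem stub_lightSliceRegular_of_slice : LocalEnergySlice → LightSliceRegular := lightSliceRegular_of_slice_holds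

/-- **β (PROVED, unconditional):** `LightSliceRegular`, from β|P and P `stub_localEnergySlice`. -/
theorem lightSliceRegular_holds : LightSliceRegular := lightSliceRegular_of_slice_holds stub_localEnergySlice

/-- β under its skeleton name. -/
theorem stub_lightSliceRegular : LightSliceRegular := lightSliceRegular_holds

section SliceLine

open Summit.NavierStokesRegularity.NavierStokesRegularity.Cruxes.TypeIQuantSubcubicExp.CubicRung

/-- ★ **LINE g14-2 / g15-1 closed down to its census node:** `SliceCensus → TypeIQuantCubicExp` (the R0-rate rung BY NAME),
from β `lightSliceRegular_holds` and `typeIQuantCubicExp_of_sliceCensus_of_lightSlice'` (`…FlatChainAssembly` part 2). -/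
theorem typeIQuantCubicExp_of_sliceCensus_alone (hcen : SliceCensus) : TypeIQuantCubicExp :=
  typeIQuantCubicExp_of_sliceCensus_of_lightSlice' hcen lightSliceRegular_holds

end SliceLine

end Summit.NavierStokesRegularity.NavierStokesRegularity.Cruxes.TypeIQuantSubcubicExp.FlatChain

end
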